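import Summits.ABC.IUTFork.Cor312PinnedRegionsThreePins
import Summits.ABC.IUTFork.Cor312PilotIdelesPrCapstone
import Summits.ABC.IUTFork.Cor312ProvenanceGenuine
import Summits.ABC.IUTFork.Thm311Real3
import Summits.ABC.IUTFork.LDHGenuinePoint
import Summits.ABC.ABC.Theorems.IUTThetaPilotABCOfThetaPartII
import Summits.ABC.ABC.Theorems.IUTThetaPilotThetaPartIIDisplay
import Summits.ABC.ABC.Theorems.IUTThetaPilotThetaPartIIStubThetaData
import HarnessLib

/-!
# Branch C certificate, INTAKE companion 2: the per-datum group of `abc_of_S_v2` AT THE GENUINE REAL SETTING OF THE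
# DATUM — `hBridge`, `hKumB` AND the q-side reading `hq` DISCHARGED BY NAME; what remains per datum is S + the two region
# pins + the ONE-SIDED Θ-side identification + named idele side conditions

C scoreboard, companion Shrink2 (`abc_of_S_shrink2`): S 1 · PIN 1 · FACT 0 · CONE 1 · READ 1 · SIDE 6 = 10 (explicit) / EFFECTIVE 21
EFFECTIVE Prop hypotheses: explicit 11 + transitive structure fields 10 = 21 [FACT-LIST 1 · SUMMIT-PROP 0 · LITERATURE-PROP 0 · CORE 6 · COMPOUND 3 · other 0 · nested structures 0] (v3: fields of project-structure DATA binders, depth ≤ 4, a nested structure type is expanded once per binder)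
Reference (tree `AbcOfS.lean` v2 `abc_of_S_v2`, p428991): S 1 · PIN 2 · FACT 0 · CONE 2 · READ 2 = 7 (explicit) / EFFECTIVE 7 + the
structure fields of its free data `TI` (6) · `F` (0) · `P312` (13) = 26 expected (tool re-run requested by C-cert-1); here `TI`/`F`/`P312`
are CONSTRUCTIONS, the 10 remaining structure-field Props are the well-formedness fields of the genuine containers X 4 (`PilotData`) ·
lat 2 · sig 2 · split 1 · qData 1 (F-2072), and the tool's «explicit 11» = the 10 `Prop` binders below + the instance-class binder
`[∀ P l T, NumberField (M P l T)]`. (Line 3 = abc-iut-w5-d035's `HypAuditScan.lean` v3 output VERBATIM for `abc_of_S_shrink2`,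
C-lead ruling C-R1. For the per-datum lemma `Shrink2.cor312Of_of_S`, whose `D`, `I` are FREE, the tool prints explicit 14 +
structure fields 66 = 80 — `InitialThetaData`/`ThetaVolumeInput` field-Props that the apex does NOT carry because its datum `T`
is PRODUCED by the proved (P7) `ThetaPartII.stub_thetaData`.)

PROOF-ONLY companion (no `def`, no new `Prop`) of `Conditional/AbcOfS.lean` v2 (abc-iut-C-cert-1, p428991; C-lead rulings C-R3/C-R6)
by the INTAKE seat abc-iut-C-cert-3; sequel of `AbcOfSShrink1.lean` (p429273, the same instantiation against v1). v2 indexes the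
certificate by the GENUINE data — a `λ`-line point `P`, a prime `l`, a Θ-volume datum `T : Cor22.ThetaVolumeDatumAt P l`
(initial Θ-data `T.D` of [IUTchI] Def. 3.1 + a genuine volume input `T.I` OF `T.D`) — and derives, per datum, `T.Cor312Of`
(`−|log(q)| ≤ −|log(Θ)|` for the datum's DEFINED numbers) from [S] `hS` · [PIN] `hPin` (two pins), `hBridge` · [CONE] `hKumB` ·
[READ] `hΘ`, `hq`, over FREE typed data `F P l T : LatticeSituation`, `P312 P l T : Cor312.Setting`. Its revision note (5)
records the intended discharge of the glue G1 «at c312-7's assembled real setting of the datum (`Real.settingPrVolSharp`: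
`negLogQ_settingPrVolSharp_eq_neg_absLogq`, `statement_settingPrVolSharp_iff`, + the Θ-side identification … — OPEN)».
THIS FILE executes the dischargeable part of that note, for ANY initial Θ-data `D` with a genuine volume input `I` OF `D`
(`ThetaData.IsVolumeInputOf D I` — for v2's datum: `T.D`, `T.I`, `T.isVolumeInputOf`):

* DATA: Dupuy–Hilado pilot data `X` OF `D` over `D`'s field `F` (abc-iut-c312-8 `Cor312Prov.IsPilotDataOf D X`; inhabited by
  `Cor312Prov.pilotDataOfF D`, `isPilotDataOf_pilotDataOfF`, p418726), the context binders of abc-iut-c312-7's print-normalised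
  real setting exactly as in `AbcOfSShrink1` (the typed lattice situation := abc-iut-c312-5's `LatticeSituation.ofShells` over
  `logShellsDH X (analyticLogv F)` with strictified columns; the setting := `settingPrVolSharp X …` with pilot regions read off
  Θ-ideles `t` and q-ideles `tq`), PR-1's region reading `ρ` and q-datum `qK`;
* DISCHARGED BY NAME: [PIN] `hBridge` := `Thm311.Real.bridgeHyps_settingPrVolSharp_of_ideles` (c312-7, p424856); [CONE] `hKumB` :=
  `rfl` (Thm. 3.11 (ii)(b) at column `n` in c312-5's strictified reading — CAVEAT as in Shrink1: non-identity Kummer transport is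
  not represented, campaign M); [READ] **`hq`** := `Thm311.Real.negLogQ_settingPrVolSharp_eq_neg_absLogq` (c312-7, p424856:
  `−|log(q)|` of the setting `= −(1/2l)·log(q)` of `D` when the q-ideles REALISE `P_q`) ∘ `Cor312Prov.negAbsLogQ_eq_neg_absLogq_of_isVolumeInputOf`
  (c312-8, p413743: the datum's defined `−|log(q)| = −(1/2l)·log(q)` of `D`) — [IUTchIV] Thm. 1.10 p. 23 «the various
  `log(q_{(−)})`'s are independent of the choice of `F□`»;
* REMAINING, per datum (explicit `Prop` binders of `Shrink2.cor312Of_of_S`): [S] `hS` · [PIN] `hPin` = the TWO-pin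
  `Cor312Vol.PinnedRegions` ((pΘ)(pq′), as v2) · [READ] `hΘ` = the ONE-SIDED Θ-side identification «the setting's verbatim
  `−|log(Θ)| ≤` the datum's defined `−|log(Θ)|`» (`P.negLogTheta ≤ ↑I.negLogTheta`, the hypothesis of c312-8's
  `cor312Of_of_statement_of_links`; the C lead's G1 Θ-half, C312-RESIDUALS §1a′ — OPEN, owners c312-7 / S7 / S3) · [SIDE] `hX`
  (`X` is the pilot data OF `D`), `htq0 htq1 ht0 ht1` (ideles non-zero, units off `S`), `htq` (the q-ideles REALISE `P_q`:
  `log ‖t_{q,v}‖ = −P_q(v)·log N(v)/n_v`, Dupuy–Hilado (3.4)).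
  SATISFIABILITY OF THE SIDE CONDITIONS (recorded, not hidden): `hX` by `pilotDataOfF D`; `htq0 htq1 ht0 ht1` by `t = tq = 1`
  trivially and by REALISING ideles whenever they exist; `htq` iff `2l ∣ ord_v(q_v)` at every `v ∈ S = 𝕍(F)^bad`
  (abc-iut-c312-3 `exists_realising_qIdeles`, p420764) — print secures this divisibility over `K ⊇ F(E[l])` ([IUTchI] Ex. 3.2
  (iv): `q̲_v = q_v^{1/2l} ∈ K_v̲`), whereas c312-8's provenance types `X` over `D`'s `F` and c312-5/c312-7's containers over the
  completions of the field of `X`: a RECORDED SEAM of the tree's typing (owners c312-7 / c312-8), under which `htq` is a genuine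
  restriction on `D`; nothing is asserted about its truth for any particular `D`.

So, per datum, v2's [PIN 2 · CONE 1 · READ 2] = 5 become [PIN 1 · READ 1] = 2 + 6 named side conditions on free data, and
v2's 19 structure-field `Prop`s of `TI`/`P312` are gone. §2 `abc_of_S_shrink2` folds §1 into v2's own Step 3 (verbatim:
`ThetaPartII.stub_thetaData`, `PointDict.logQAvoid_le_of_cor312AtDatum`, `ThetaPartIIDisplay.thm110Legendre_of_squeezeIII`,
`ABC_of_thm110Legendre`) under `T`'s bundled instances, keeping the (P,l)-level binder `hvol` ((ii′) hull-volume estimate, layer S)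
VERBATIM. MOVEMENT v2 → Shrink2: explicit 7 → 10 (PIN 2→1, CONE 2→1, READ 2→1, SIDE 0→6) · EFFECTIVE 26 → 21; the
SUBSTANTIVE classes S + PIN + CONE + READ: 7 → 4 (`hS`, `hPin`, `hvol`, `hΘ`). Folding into `AbcOfS.lean` itself (append
`abc_of_S_v3`) is abc-iut-C-cert-1/2's call (parity) — this companion is importable as is.

HONEST FRAMING: this campaign LOCATES / CONDITIONALLY VERIFIES. Nothing here asserts that abc is proved or refuted, or that
[IUTchIII] Cor. 3.12 / Thm. 3.11 holds or fails, or takes a side on any author (Mochizuki / Scholze–Stix / Joshi /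
Dupuy–Hilado); «`T.Cor312Of` follows from S + the listed hypotheses AS TYPED, at these data», nothing more; S is an assumption
label; typed ≠ proved; instantiated ≠ endorsed. [claim: Mochizuki2012, status: disputed] [cite: DupuyHilado2025, §3.3–§3.4]
[cite: Mochizuki2012, IUTchIV Thm. 1.10 p. 23; IUTchI Ex. 3.2 (iv) p. 71]
-/

noncomputable section

open Set Function NumberField IsDedekindDomain

namespace Summit.ABC.IUTFork.Conditional

open Thm311 Thm311.Real Cor312 Cor312Vol Cor312Prov Literature.IUT.LogThetaLattice Literature.IUT.LogVolume
  Literature.IUT.HodgeTheaters Literature.IUT.LogVolume.ThetaData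

/-! ## §1. One datum: `I.Cor312Of` at the genuine real setting of `D` from S + two pins + Θ-side identification + side conditions -/

section PerDatum

variable {F K Fbar : Type} [Field F] [NumberField F] [Field K] [NumberField K] [Algebra F K] [Field Fbar]
  [Algebra F Fbar] [Algebra K Fbar] {E : WeierstrassCurve F} [E.IsElliptic] {l : ℕ} {Pb : BadPlacePredicates K}
  (D : InitialThetaData F K Fbar E l Pb) {I : ThetaVolumeInput (fieldOfModuli E) K}
  (X : PilotData F) (M : Type) [Field M] [NumberField M]
  (archPk : ∀ (j : (thetaIndex X).Label) (vQ : (thetaIndex X).VQ), Set ((logShellsDH X (analyticLogv F)).Packet j vQ))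
  (archSub : ∀ (j : (thetaIndex X).Label) (v : (thetaIndex X).V),
    Set ((logShellsDH X (analyticLogv F)).Packet j ((thetaIndex X).over v)))
  (Ψ : ℤ → ∀ v : (thetaIndex X).V, v ∈ (thetaIndex X).Vbad → Set ((logShellsDH X (analyticLogv F)).StarPacket v))
  (act : ℤ → ∀ v : (thetaIndex X).V, v ∈ (thetaIndex X).Vbad →
    (logShellsDH X (analyticLogv F)).StarPacket v → Module.End ℚ ((logShellsDH X (analyticLogv F)).StarPacket v))
  (Mmod : ℤ → ∀ j : (thetaIndex X).LabelStar, Set ((logShellsDH X (analyticLogv F)).GlobalPacket j.1))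
  (region : ℤ → ∀ j : (thetaIndex X).LabelStar, FinDivisor M → ∀ vQ : (thetaIndex X).VQ,
    Set ((logShellsDH X (analyticLogv F)).Packet j.1 vQ))
  (frobAdm : ℤ → ℤ → ∀ (j : (thetaIndex X).Label) (vQ : (thetaIndex X).VQ),
    Set ((logShellsDH X (analyticLogv F)).Packet j vQ) → Prop)
  (frobLogvol : ℤ → ℤ → ∀ (j : (thetaIndex X).Label) (vQ : (thetaIndex X).VQ),
    Set ((logShellsDH X (analyticLogv F)).Packet j vQ) → ℝ)
  (frobMmod : ℤ → ℤ → ∀ j : (thetaIndex X).LabelStar, Set ((logShellsDH X (analyticLogv F)).GlobalPacket j.1))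
  (unitImage : ℤ → ℤ → ℕ → ∀ (j : (thetaIndex X).Label) (vQ : (thetaIndex X).VQ),
    Set ((logShellsDH X (analyticLogv F)).Packet j vQ))
  (ballImage : ℤ → ℤ → ∀ (j : (thetaIndex X).Label) (vQ : (thetaIndex X).VQ),
    Set ((logShellsDH X (analyticLogv F)).Packet j vQ))
  (thetaDiv : ℤ → ℤ → LgpDivisor M (thetaIndex X).lstar)
  (n : ℤ) {HT : Type} {LogLink : HT → HT → Type} {IsFull : ∀ {s t : HT}, LogLink s t → Prop}
  (lat : LGPGaussianLogThetaLattice LogLink IsFull)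
  {Frd : Type} {IsoF : Frd → Frd → Type} {Ob : Frd → Type} {realify : Frd → Frd} {Strip : Type}
  {IsoS : Strip → Strip → Type} {Mv : ∀ v : (thetaIndex X).V, v ∈ (thetaIndex X).Vbad → Type}
  [∀ v h, Monoid (Mv v h)]
  (sig : GlobalLGPFrobenioidSignature (thetaIndex X).lstar (thetaIndex X).V (· ∈ (thetaIndex X).Vbad)
    Frd IsoF Ob realify Strip IsoS Mv)
  (split : SplittingMonoids Mv) {ObΔ : Type} {N : ∀ v : (thetaIndex X).V, v ∈ (thetaIndex X).Vbad → Type}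
  [∀ v h, Monoid (N v h)] (qData : QPilotData ObΔ N)
  (t : ∀ (pp : Nat.Primes) (_ : Fin X.lstar) (x : (thetaIndex X).Fibre (.inr pp)),
    haveI : Fact (pp : ℕ).Prime := ⟨pp.2⟩; kOf X pp.1 x)
  (tq : ∀ (pp : Nat.Primes) (x : (thetaIndex X).Fibre (.inr pp)), haveI : Fact (pp : ℕ).Prime := ⟨pp.2⟩; kOf X pp.1 x)
  (ρ : (∀ v : (thetaIndex X).V, v ∈ (thetaIndex X).Vbad → Set ((logShellsDH X (analyticLogv F)).StarPacket v)) →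
    ∀ (j : (thetaIndex X).Label) (vQ : (thetaIndex X).VQ), Set ((logShellsDH X (analyticLogv F)).Packet j vQ))
  (qK : ∀ v : (thetaIndex X).V, v ∈ (thetaIndex X).Vbad → Set ((logShellsDH X (analyticLogv F)).StarPacket v))

/-- **One datum, genuine real setting: `I.Cor312Of` (`−|log(q)| ≤ −|log(Θ)|` for the DEFINED numbers of a genuine Θ-volume
input `I` OF the initial Θ-data `D`) FROM: S (`PilotKummerIndRelated`), the two region pins, the one-sided Θ-side
identification `hΘ`, and the named side conditions (`hX`, idele conditions, `htq`).** Route, by name: c312-7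
`bridgeHyps_settingPrVolSharp_of_ideles` (p424856) + Thm. 3.11 (ii)(b)@n := `rfl` + PR-1 `reading3_iff_pilotKummerIndRelated` +
c312-6 `statement_of_qRegion_mem_possibleImages` ⟹ the verbatim `Statement` of `settingPrVolSharp X …`; q-side: c312-7
`negLogQ_settingPrVolSharp_eq_neg_absLogq` + c312-8 `negAbsLogQ_eq_neg_absLogq_of_isVolumeInputOf`; Θ-side: `hΘ`. «`I.Cor312Of`
follows from S + these hypotheses as typed, at these data» — no side taken. [claim: Mochizuki2012, status: disputed] -/
theorem Shrink2.cor312Of_of_S (hI : ThetaData.IsVolumeInputOf D I) (hX : Cor312Prov.IsPilotDataOf D X)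
    (htq0 : ∀ pp x, tq pp x ≠ 0)
    (htq1 : ∀ (pp : Nat.Primes) (x : (thetaIndex X).Fibre (.inr pp)),
      haveI : Fact (pp : ℕ).Prime := ⟨pp.2⟩; placeOf X pp.1 x ∉ X.S → ‖tq pp x‖ = 1)
    (ht0 : ∀ pp i x, t pp i x ≠ 0)
    (ht1 : ∀ (pp : Nat.Primes) (i : Fin X.lstar) (x : (thetaIndex X).Fibre (.inr pp)),
      haveI : Fact (pp : ℕ).Prime := ⟨pp.2⟩; placeOf X pp.1 x ∉ X.S → ‖t pp i x‖ = 1)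
    (htq : ∀ (pp : Nat.Primes) (x : (thetaIndex X).Fibre (.inr pp)),
      haveI : Fact (pp : ℕ).Prime := ⟨pp.2⟩
      Real.log ‖tq pp x‖ = -(X.qPilot (placeOf X pp.1 x)) * logNorm F (placeOf X pp.1 x) /
        localDegree F (placeOf X pp.1 x))
    (hS : Cor312Vol.PilotKummerIndRelated
      (LatticeSituation.ofShells (logShellsDH X (analyticLogv F)) M archPk archSub
        (summandPiecesPr X (logvAnalytic_analyticLogv (F := F))).Adm
        (summandPiecesPr X (logvAnalytic_analyticLogv (F := F))).logvol Ψ act Mmod region frobAdm frobLogvol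
        (fun k _ => Ψ k) frobMmod unitImage ballImage thetaDiv)
      (settingPrVolSharp X (logvAnalytic_analyticLogv (F := F)) M archPk archSub Ψ act Mmod region n lat sig split qData
        tq t htq0 htq1) ρ qK)
    (hPin : Cor312Vol.PinnedRegions
      (LatticeSituation.ofShells (logShellsDH X (analyticLogv F)) M archPk archSub
        (summandPiecesPr X (logvAnalytic_analyticLogv (F := F))).Adm
        (summandPiecesPr X (logvAnalytic_analyticLogv (F := F))).logvol Ψ act Mmod region frobAdm frobLogvol
        (fun k _ => Ψ k) frobMmod unitImage ballImage thetaDiv)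
      (settingPrVolSharp X (logvAnalytic_analyticLogv (F := F)) M archPk archSub Ψ act Mmod region n lat sig split qData
        tq t htq0 htq1) ρ qK)
    (hΘ : (settingPrVolSharp X (logvAnalytic_analyticLogv (F := F)) M archPk archSub Ψ act Mmod region n lat sig split qData
        tq t htq0 htq1).negLogTheta ≤
      ((I.negLogTheta : ℝ) : WithTop ℝ)) :
    I.Cor312Of := by
  -- Step 1: the verbatim Statement of Cor. 3.12 at the genuine setting — hBridge := p424856, hKumB := rfl, R3 ⟸ S under the two pins
  have hst :
      (settingPrVolSharp X (logvAnalytic_analyticLogv (F := F)) M archPk archSub Ψ act Mmod region n lat sig split qData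
        tq t htq0 htq1).Statement :=
    Cor312Vol.statement_of_qRegion_mem_possibleImages
      (bridgeHyps_settingPrVolSharp_of_ideles X (logvAnalytic_analyticLogv (F := F)) M archPk archSub Ψ act Mmod region n lat
        sig split qData t tq ht0 ht1 htq0 htq1)
      fun i vQ =>
        (Cor312Vol.reading3_iff_pilotKummerIndRelated
          (LatticeSituation.ofShells (logShellsDH X (analyticLogv F)) M archPk archSub
        (summandPiecesPr X (logvAnalytic_analyticLogv (F := F))).Adm
        (summandPiecesPr X (logvAnalytic_analyticLogv (F := F))).logvol Ψ act Mmod region frobAdm frobLogvol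
        (fun k _ => Ψ k) frobMmod unitImage ballImage thetaDiv)
          (settingPrVolSharp X (logvAnalytic_analyticLogv (F := F)) M archPk archSub Ψ act Mmod region n lat sig split qData
        tq t htq0 htq1) ρ qK
          (fun _ _ _ => rfl) hPin).2 hS (Cor312.Setting.labelSucc i) vQ
  -- Step 2: the q-side by provenance — `−|log(q)|` of the setting and of the input are both `−(1/2l)·log(q)` of `D`
  have hq := negLogQ_settingPrVolSharp_eq_neg_absLogq X (logvAnalytic_analyticLogv (F := F)) M archPk archSub Ψ act Mmod
    region n lat sig split qData t tq hX htq0 htq1 htq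
  obtain ⟨-, hle⟩ := hst
  rw [hq] at hle
  -- Step 3: the Θ-side by the one-sided identification `hΘ`
  show I.negAbsLogQ ≤ I.negLogTheta
  rw [Cor312Prov.negAbsLogQ_eq_neg_absLogq_of_isVolumeInputOf D hI]
  exact WithTop.coe_le_coe.mp (hle.trans hΘ)

end PerDatum

/-! ## §2. The apex: `abc_of_S_v2`'s chain with the per-datum group AT THE GENUINE REAL SETTING (§1 folded in under `T`'s instances) -/

section Family

open Literature.NumberTheory.DiophantineGeometry.GenEll Summit.ABC.ABC.Theorems

/-- **`abc_of_S_shrink2` (branch C certificate v2 AT THE GENUINE REAL SETTING OF EACH DATUM; per datum explicit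
S 1 · PIN 1 · FACT 0 · CONE 0 · READ 1 · SIDE 6 = 9, plus the (P,l)-level CONE binder `hvol` of v2 verbatim; v2 per-datum binders
DISCHARGED: `hBridge`, `hKumB`, `hq`).** `ABC` from, per `λ`-line point `P`, prime `l` and genuine Θ-volume datum
`T : Cor22.ThetaVolumeDatumAt P l`: DATA = Dupuy–Hilado pilot data `X P l T` over `T.F`, the context binders of c312-7's
print-normalised real setting (as in `AbcOfSShrink1`), Θ-ideles and q-ideles, PR-1's `ρ`, `qK`; HYPOTHESES = [SIDE] `hX` (`X P l T` is the
pilot data OF `T.D`), `htq0 htq1 ht0 ht1`, `htq` (q-ideles realise `P_q`; satisfiable iff `2l ∣ ord_v(q_v)` on `S`, module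
docstring) · [S] `hS` · [PIN] `hPin` (two pins) · [READ] `hΘ` (ONE-SIDED Θ-side identification) · [CONE] `hvol` ((ii′), layer S,
exactly v2's). Proof: §1 `Shrink2.cor312Of_of_S` at `T.D`, `T.I`, `T.isVolumeInputOf` gives `Cor22.Cor312AtDatum P l`; then v2's
Step 3 verbatim (`ThetaPartII.stub_thetaData`, `PointDict.logQAvoid_le_of_cor312AtDatum`, `ThetaPartIIDisplay.thm110Legendre_of_squeezeIII`,
`ABC_of_thm110Legendre`). «`ABC` follows from S + these hypotheses as typed, at these data» — no side taken on [IUTchIII]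
Cor. 3.12; typed ≠ proved; instantiated ≠ endorsed. [claim: Mochizuki2012, status: disputed] -/
theorem abc_of_S_shrink2
    -- DATA, per datum: pilot data over `T.F`, the context binders of the genuine real setting (logs FIXED: analytic), ideles, ρ, qK
    (X : ∀ (P : NFPoint) (l : ℕ) (T : Cor22.ThetaVolumeDatumAt P l), @PilotData T.F T.instFieldF T.instNumberFieldF)
    (M : ∀ (P : NFPoint) (l : ℕ) (T : Cor22.ThetaVolumeDatumAt P l), Type) [∀ P l T, Field (M P l T)] [∀ P l T, NumberField (M P l T)]
    (archPk : ∀ (P : NFPoint) (l : ℕ) (T : Cor22.ThetaVolumeDatumAt P l), letI := T.instFieldF; letI := T.instNumberFieldF;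
      ∀ (j : (thetaIndex (X P l T)).Label) (vQ : (thetaIndex (X P l T)).VQ), Set ((logShellsDH (X P l T) (analyticLogv T.F)).Packet j vQ))
    (archSub : ∀ (P : NFPoint) (l : ℕ) (T : Cor22.ThetaVolumeDatumAt P l), letI := T.instFieldF; letI := T.instNumberFieldF;
      ∀ (j : (thetaIndex (X P l T)).Label) (v : (thetaIndex (X P l T)).V), Set ((logShellsDH (X P l T) (analyticLogv T.F)).Packet j ((thetaIndex (X P l T)).over v)))
    (Ψ : ∀ (P : NFPoint) (l : ℕ) (T : Cor22.ThetaVolumeDatumAt P l), letI := T.instFieldF; letI := T.instNumberFieldF;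
      ℤ → ∀ v : (thetaIndex (X P l T)).V, v ∈ (thetaIndex (X P l T)).Vbad → Set ((logShellsDH (X P l T) (analyticLogv T.F)).StarPacket v))
    (act : ∀ (P : NFPoint) (l : ℕ) (T : Cor22.ThetaVolumeDatumAt P l), letI := T.instFieldF; letI := T.instNumberFieldF;
      ℤ → ∀ v : (thetaIndex (X P l T)).V, v ∈ (thetaIndex (X P l T)).Vbad → (logShellsDH (X P l T) (analyticLogv T.F)).StarPacket v → Module.End ℚ ((logShellsDH (X P l T) (analyticLogv T.F)).StarPacket v))
    (Mmod : ∀ (P : NFPoint) (l : ℕ) (T : Cor22.ThetaVolumeDatumAt P l), letI := T.instFieldF; letI := T.instNumberFieldF;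
      ℤ → ∀ j : (thetaIndex (X P l T)).LabelStar, Set ((logShellsDH (X P l T) (analyticLogv T.F)).GlobalPacket j.1))
    (region : ∀ (P : NFPoint) (l : ℕ) (T : Cor22.ThetaVolumeDatumAt P l), letI := T.instFieldF; letI := T.instNumberFieldF;
      ℤ → ∀ j : (thetaIndex (X P l T)).LabelStar, FinDivisor (M P l T) → ∀ vQ : (thetaIndex (X P l T)).VQ, Set ((logShellsDH (X P l T) (analyticLogv T.F)).Packet j.1 vQ))
    (frobAdm : ∀ (P : NFPoint) (l : ℕ) (T : Cor22.ThetaVolumeDatumAt P l), letI := T.instFieldF; letI := T.instNumberFieldF;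
      ℤ → ℤ → ∀ (j : (thetaIndex (X P l T)).Label) (vQ : (thetaIndex (X P l T)).VQ), Set ((logShellsDH (X P l T) (analyticLogv T.F)).Packet j vQ) → Prop)
    (frobLogvol : ∀ (P : NFPoint) (l : ℕ) (T : Cor22.ThetaVolumeDatumAt P l), letI := T.instFieldF; letI := T.instNumberFieldF;
      ℤ → ℤ → ∀ (j : (thetaIndex (X P l T)).Label) (vQ : (thetaIndex (X P l T)).VQ), Set ((logShellsDH (X P l T) (analyticLogv T.F)).Packet j vQ) → ℝ)
    (frobMmod : ∀ (P : NFPoint) (l : ℕ) (T : Cor22.ThetaVolumeDatumAt P l), letI := T.instFieldF; letI := T.instNumberFieldF;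
      ℤ → ℤ → ∀ j : (thetaIndex (X P l T)).LabelStar, Set ((logShellsDH (X P l T) (analyticLogv T.F)).GlobalPacket j.1))
    (unitImage : ∀ (P : NFPoint) (l : ℕ) (T : Cor22.ThetaVolumeDatumAt P l), letI := T.instFieldF; letI := T.instNumberFieldF;
      ℤ → ℤ → ℕ → ∀ (j : (thetaIndex (X P l T)).Label) (vQ : (thetaIndex (X P l T)).VQ), Set ((logShellsDH (X P l T) (analyticLogv T.F)).Packet j vQ))
    (ballImage : ∀ (P : NFPoint) (l : ℕ) (T : Cor22.ThetaVolumeDatumAt P l), letI := T.instFieldF; letI := T.instNumberFieldF;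
      ℤ → ℤ → ∀ (j : (thetaIndex (X P l T)).Label) (vQ : (thetaIndex (X P l T)).VQ), Set ((logShellsDH (X P l T) (analyticLogv T.F)).Packet j vQ))
    (thetaDiv : ∀ (P : NFPoint) (l : ℕ) (T : Cor22.ThetaVolumeDatumAt P l), letI := T.instFieldF; letI := T.instNumberFieldF;
      ℤ → ℤ → LgpDivisor (M P l T) (thetaIndex (X P l T)).lstar)
    (n : ∀ (P : NFPoint) (l : ℕ) (T : Cor22.ThetaVolumeDatumAt P l), ℤ)
    {HT : ∀ (P : NFPoint) (l : ℕ) (T : Cor22.ThetaVolumeDatumAt P l), Type} {LogLink : ∀ (P : NFPoint) (l : ℕ) (T : Cor22.ThetaVolumeDatumAt P l), HT P l T → HT P l T → Type}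
    {IsFull : ∀ (P : NFPoint) (l : ℕ) (T : Cor22.ThetaVolumeDatumAt P l), ∀ {s t : HT P l T}, LogLink P l T s t → Prop}
    (lat : ∀ (P : NFPoint) (l : ℕ) (T : Cor22.ThetaVolumeDatumAt P l), LGPGaussianLogThetaLattice (LogLink P l T) (IsFull P l T))
    {Frd : ∀ (P : NFPoint) (l : ℕ) (T : Cor22.ThetaVolumeDatumAt P l), Type} {IsoF : ∀ (P : NFPoint) (l : ℕ) (T : Cor22.ThetaVolumeDatumAt P l), Frd P l T → Frd P l T → Type} {Ob : ∀ (P : NFPoint) (l : ℕ) (T : Cor22.ThetaVolumeDatumAt P l), Frd P l T → Type}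
    {realify : ∀ (P : NFPoint) (l : ℕ) (T : Cor22.ThetaVolumeDatumAt P l), Frd P l T → Frd P l T} {Strip : ∀ (P : NFPoint) (l : ℕ) (T : Cor22.ThetaVolumeDatumAt P l), Type} {IsoS : ∀ (P : NFPoint) (l : ℕ) (T : Cor22.ThetaVolumeDatumAt P l), Strip P l T → Strip P l T → Type}
    {Mv : ∀ (P : NFPoint) (l : ℕ) (T : Cor22.ThetaVolumeDatumAt P l), letI := T.instFieldF; letI := T.instNumberFieldF;
      ∀ v : (thetaIndex (X P l T)).V, v ∈ (thetaIndex (X P l T)).Vbad → Type}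
    [∀ P l T v h, Monoid (Mv P l T v h)]
    (sig : ∀ (P : NFPoint) (l : ℕ) (T : Cor22.ThetaVolumeDatumAt P l), letI := T.instFieldF; letI := T.instNumberFieldF;
      GlobalLGPFrobenioidSignature (thetaIndex (X P l T)).lstar (thetaIndex (X P l T)).V (· ∈ (thetaIndex (X P l T)).Vbad) (Frd P l T) (IsoF P l T) (Ob P l T) (realify P l T)
        (Strip P l T) (IsoS P l T) (Mv P l T))
    (split : ∀ (P : NFPoint) (l : ℕ) (T : Cor22.ThetaVolumeDatumAt P l), SplittingMonoids (Mv P l T))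
    {ObΔ : ∀ (P : NFPoint) (l : ℕ) (T : Cor22.ThetaVolumeDatumAt P l), Type} {N : ∀ (P : NFPoint) (l : ℕ) (T : Cor22.ThetaVolumeDatumAt P l), letI := T.instFieldF; letI := T.instNumberFieldF;
      ∀ v : (thetaIndex (X P l T)).V, v ∈ (thetaIndex (X P l T)).Vbad → Type}
    [∀ P l T v h, Monoid (N P l T v h)] (qData : ∀ (P : NFPoint) (l : ℕ) (T : Cor22.ThetaVolumeDatumAt P l), QPilotData (ObΔ P l T) (N P l T))
    (t : ∀ (P : NFPoint) (l : ℕ) (T : Cor22.ThetaVolumeDatumAt P l), letI := T.instFieldF; letI := T.instNumberFieldF;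
      ∀ (pp : Nat.Primes) (_ : Fin (X P l T).lstar) (x : (thetaIndex (X P l T)).Fibre (.inr pp)), haveI : Fact (pp : ℕ).Prime := ⟨pp.2⟩; kOf (X P l T) pp.1 x)
    (tq : ∀ (P : NFPoint) (l : ℕ) (T : Cor22.ThetaVolumeDatumAt P l), letI := T.instFieldF; letI := T.instNumberFieldF;
      ∀ (pp : Nat.Primes) (x : (thetaIndex (X P l T)).Fibre (.inr pp)), haveI : Fact (pp : ℕ).Prime := ⟨pp.2⟩; kOf (X P l T) pp.1 x)
    (ρ : ∀ (P : NFPoint) (l : ℕ) (T : Cor22.ThetaVolumeDatumAt P l), letI := T.instFieldF; letI := T.instNumberFieldF;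
      (∀ v : (thetaIndex (X P l T)).V, v ∈ (thetaIndex (X P l T)).Vbad → Set ((logShellsDH (X P l T) (analyticLogv T.F)).StarPacket v)) → ∀ (j : (thetaIndex (X P l T)).Label) (vQ : (thetaIndex (X P l T)).VQ), Set ((logShellsDH (X P l T) (analyticLogv T.F)).Packet j vQ))
    (qK : ∀ (P : NFPoint) (l : ℕ) (T : Cor22.ThetaVolumeDatumAt P l), letI := T.instFieldF; letI := T.instNumberFieldF;
      ∀ v : (thetaIndex (X P l T)).V, v ∈ (thetaIndex (X P l T)).Vbad → Set ((logShellsDH (X P l T) (analyticLogv T.F)).StarPacket v))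
    -- [SIDE] `X` is the pilot data OF `T.D`; the ideles are non-zero, units off `S`; the q-ideles REALISE `P_q`
    (hX : ∀ (P : NFPoint) (l : ℕ) (T : Cor22.ThetaVolumeDatumAt P l), letI := T.instFieldF; letI := T.instNumberFieldF; letI := T.instAlgebraF; letI := T.instFieldK;
        letI := T.instNumberFieldK; letI := T.instAlgebraK; letI := T.instFieldFbar; letI := T.instAlgebraFbar;
        letI := T.instAlgebraKFbar; letI := T.instIsElliptic;
      Cor312Prov.IsPilotDataOf T.D (X P l T))
    (htq0 : ∀ P l T pp x, tq P l T pp x ≠ 0)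
    (htq1 : ∀ (P : NFPoint) (l : ℕ) (T : Cor22.ThetaVolumeDatumAt P l), letI := T.instFieldF; letI := T.instNumberFieldF;
      ∀ (pp : Nat.Primes) (x : (thetaIndex (X P l T)).Fibre (.inr pp)),
        haveI : Fact (pp : ℕ).Prime := ⟨pp.2⟩; placeOf (X P l T) pp.1 x ∉ (X P l T).S → ‖tq P l T pp x‖ = 1)
    (ht0 : ∀ P l T pp i x, t P l T pp i x ≠ 0)
    (ht1 : ∀ (P : NFPoint) (l : ℕ) (T : Cor22.ThetaVolumeDatumAt P l), letI := T.instFieldF; letI := T.instNumberFieldF;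
      ∀ (pp : Nat.Primes) (i : Fin (X P l T).lstar) (x : (thetaIndex (X P l T)).Fibre (.inr pp)),
        haveI : Fact (pp : ℕ).Prime := ⟨pp.2⟩; placeOf (X P l T) pp.1 x ∉ (X P l T).S → ‖t P l T pp i x‖ = 1)
    (htq : ∀ (P : NFPoint) (l : ℕ) (T : Cor22.ThetaVolumeDatumAt P l), letI := T.instFieldF; letI := T.instNumberFieldF;
      ∀ (pp : Nat.Primes) (x : (thetaIndex (X P l T)).Fibre (.inr pp)),
        haveI : Fact (pp : ℕ).Prime := ⟨pp.2⟩
        Real.log ‖tq P l T pp x‖ = -((X P l T).qPilot (placeOf (X P l T) pp.1 x)) * logNorm T.F (placeOf (X P l T) pp.1 x) /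
          localDegree T.F (placeOf (X P l T) pp.1 x))
    -- [S] the single named proposition, at every datum, AT THESE DATA
    (hS : ∀ (P : NFPoint) (l : ℕ) (T : Cor22.ThetaVolumeDatumAt P l), letI := T.instFieldF; letI := T.instNumberFieldF;
      Cor312Vol.PilotKummerIndRelated
        (LatticeSituation.ofShells (logShellsDH (X P l T) (analyticLogv T.F)) (M P l T) (archPk P l T)
          (archSub P l T) (summandPiecesPr (X P l T) (logvAnalytic_analyticLogv (F := T.F))).Adm
          (summandPiecesPr (X P l T) (logvAnalytic_analyticLogv (F := T.F))).logvol (Ψ P l T) (act P l T) (Mmod P l T)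
          (region P l T) (frobAdm P l T) (frobLogvol P l T) (fun k _ => Ψ P l T k) (frobMmod P l T) (unitImage P l T)
          (ballImage P l T) (thetaDiv P l T))
        (settingPrVolSharp (X P l T) (logvAnalytic_analyticLogv (F := T.F)) (M P l T) (archPk P l T) (archSub P l T) (Ψ P l T)
          (act P l T) (Mmod P l T) (region P l T) (n P l T) (lat P l T) (sig P l T) (split P l T) (qData P l T) (tq P l T)
          (t P l T) (htq0 P l T) (htq1 P l T)) (ρ P l T) (qK P l T))
    -- [PIN] the Corollary's own region pins (pΘ)(pq′), AT THESE DATA (`hBridge` is no longer a binder: p424856)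
    (hPin : ∀ (P : NFPoint) (l : ℕ) (T : Cor22.ThetaVolumeDatumAt P l), letI := T.instFieldF; letI := T.instNumberFieldF;
      Cor312Vol.PinnedRegions
        (LatticeSituation.ofShells (logShellsDH (X P l T) (analyticLogv T.F)) (M P l T) (archPk P l T)
          (archSub P l T) (summandPiecesPr (X P l T) (logvAnalytic_analyticLogv (F := T.F))).Adm
          (summandPiecesPr (X P l T) (logvAnalytic_analyticLogv (F := T.F))).logvol (Ψ P l T) (act P l T) (Mmod P l T)
          (region P l T) (frobAdm P l T) (frobLogvol P l T) (fun k _ => Ψ P l T k) (frobMmod P l T) (unitImage P l T)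
          (ballImage P l T) (thetaDiv P l T))
        (settingPrVolSharp (X P l T) (logvAnalytic_analyticLogv (F := T.F)) (M P l T) (archPk P l T) (archSub P l T) (Ψ P l T)
          (act P l T) (Mmod P l T) (region P l T) (n P l T) (lat P l T) (sig P l T) (split P l T) (qData P l T) (tq P l T)
          (t P l T) (htq0 P l T) (htq1 P l T)) (ρ P l T) (qK P l T))
    -- [FACT] (none) · [CONE] (ii′) the hull-volume estimate at the genuine data, layer S — v2's `hvol` VERBATIM
    --   (`hKumB` is no longer a binder: `rfl` in the strictified reading)
    (hvol : ∀ P : NFPoint, P ∈ UP → ∀ l : ℕ, l.Prime → 5 ≤ l →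
      Cor22.AdmitsCore P → Cor22.CondP2 P l → Cor22.CondP5 P l → Cor22.CondP6 P l →
        Cor22.HullVolumeAtDatum P l (((l : ℝ) + 1) / 4 *
          ((1 + 12 * (Cor22.dmod P : ℝ) / l) * (P.logDiff + Cor22.logCondAvoid P {2, l})
            + 2 * Real.log l + 52
            + 20 / 3 * Real.log (((2 ^ 12 * 3 ^ 3 * 5 * Cor22.dmod P : ℕ) : ℝ) * (l : ℝ))
              * (Nat.primeCounting (2 ^ 12 * 3 ^ 3 * 5 * Cor22.dmod P * l) : ℝ))))
    -- [READ] the ONE-SIDED Θ-side identification: the genuine setting's verbatim `−|log(Θ)|` ≤ the datum's defined one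
    --   (`hq` is no longer a binder: c312-7 p424856 ∘ c312-8 p413743)
    (hΘ : ∀ (P : NFPoint) (l : ℕ) (T : Cor22.ThetaVolumeDatumAt P l), letI := T.instFieldF; letI := T.instNumberFieldF;
      (settingPrVolSharp (X P l T) (logvAnalytic_analyticLogv (F := T.F)) (M P l T) (archPk P l T) (archSub P l T) (Ψ P l T)
          (act P l T) (Mmod P l T) (region P l T) (n P l T) (lat P l T) (sig P l T) (split P l T) (qData P l T) (tq P l T)
          (t P l T) (htq0 P l T) (htq1 P l T)).negLogTheta ≤
        ((T.negLogTheta : ℝ) : WithTop ℝ)) :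
    _root_.ABC := by
  -- Step 1–2: [IUTchIII] Cor 3.12 at EVERY genuine Θ-volume datum, AT ITS GENUINE REAL SETTING (§1 under `T`'s bundled instances)
  have h312 : ∀ (P : NFPoint) (l : ℕ), Cor22.Cor312AtDatum P l := fun P l T => by
    letI := T.instFieldF; letI := T.instNumberFieldF; letI := T.instAlgebraF; letI := T.instFieldK
    letI := T.instNumberFieldK; letI := T.instAlgebraK; letI := T.instFieldFbar; letI := T.instAlgebraFbar
    letI := T.instAlgebraKFbar; letI := T.instIsElliptic
    exact Shrink2.cor312Of_of_S T.D (X P l T) (M P l T) (archPk P l T) (archSub P l T) (Ψ P l T) (act P l T) (Mmod P l T)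
      (region P l T) (frobAdm P l T) (frobLogvol P l T) (frobMmod P l T) (unitImage P l T) (ballImage P l T) (thetaDiv P l T)
      (n P l T) (lat P l T) (sig P l T) (split P l T) (qData P l T) (t P l T) (tq P l T) (ρ P l T) (qK P l T)
      T.isVolumeInputOf (hX P l T) (htq0 P l T) (htq1 P l T) (ht0 P l T) (ht1 P l T) (htq P l T) (hS P l T) (hPin P l T)
      (hΘ P l T)
  -- Step 3 (v2 verbatim): the squeeze at every admissible (P, l) through a genuine datum ((P7), PROVED), then the campaign-S chain
  refine ABC_of_thm110Legendre (ThetaPartIIDisplay.thm110Legendre_of_squeezeIII fun P hP l hl h5 hc h2 h5' h6 => ?_)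
  obtain ⟨T⟩ := ThetaPartII.stub_thetaData P hP l hl h5 hc h2 h5' h6
  exact PointDict.logQAvoid_le_of_cor312AtDatum (h312 P l) (hvol P hP l hl h5 hc h2 h5' h6) T hP.1

end Family

end Summit.ABC.IUTFork.Conditional

end
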